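import Literature.AlgebraicGeometry.Motives.CrystallineRealization
import Literature.AlgebraicGeometry.Motives.PeriodComparison
import HarnessLib

/-!
# `φ`-Tate classes "on the nose" at a `p`-adic anchor: the formal consequences
# (helper for `AnchorsAtGenericHodgeLocusPoints`, stmt-HodgeConjecture-13944)

Route `PadicSemiregularLift` of `HodgeConjecture`, informal support item P2b
`AnchorsAtGenericHodgeLocusPoints` ("cohomologically supersingular `p`-adic anchors at `ℚ̄`-generic
points of Hodge loci — abelian and Fermat type"). The item has no Lean signature yet; in the typed
vocabulary the route already uses (crux work-file `Cruxes/SemiregularSeedsOnAnchors/TypedCrux.lean`,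
Theorems file `PadicSemiregularLiftGrothendieckExistenceDescent.lean`) its two key predicates are

* **`φ`-Tate ON THE NOSE** for a de Rham class `α ∈ H²ʳ_dR(X_K/K)` on the generic fibre of a smooth
  proper model `𝒳/W(k)`: `α = bo x` for some `x ∈ H²ʳ_cris(X_k/W) ⊗ K` with `φ x = pʳ x`, i.e.
  `∃ x ∈ C.tateClasses (specialFibre 𝒳) r, C.bo 𝒳 (2 * r) x = α` (Ogus 1982, (4.1.2): "absolutely
  Tate" classes; `C : Motives.CrystallineRealization p k`, `bo` = Berthelot–Ogus);
* **COHOMOLOGICALLY SUPERSINGULAR** special fibre: `C.algebraicClasses (specialFibre 𝒳) r = ⊤` for all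
  `r` (every class of `H²ʳ_cris ⊗ K` is a `K`-combination of algebraic classes: `ρ_r = b_{2r}`).

This file proves, sorry-free and for EVERY value of the hypothesis structures, the formal facts about
these predicates that any typing of the item and its consumers (P2a `SemiregularSeedsOnAnchors`, the
assembly) use:

* `ratCast_smul_mem_tateClasses`, `zsmul_mem_tateClasses'` — the `φ = pʳ` eigenspace is a
  `ℚ`-structure (stable under rational scalars: `φ` is `σ`-semilinear and `σ` fixes `ℚ`), though not
  a `K`-subspace;
* `span_tateClasses_eq_top_of_algebraicClasses_eq_top` — on a cohomologically supersingular smooth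
  projective `X/k`, `H²ʳ(X)` is SPANNED over `K` by the `φ`-Tate classes (algebraic classes are Tate,
  `CrystallineRealization.algebraicLattice_le_tateClasses`, Ogus 1982 §4), and its generic-fibre form
  `span_bo_image_tateClasses_eq_top`: at an anchor, `H²ʳ_dR(X_K/K)` is spanned by classes that are
  `φ`-Tate on the nose (Berthelot–Ogus: `bo` is bijective) — the precise sense in which "Tate is free"
  at an anchor;
* `exists_tateClasses_bo_eq_iff_symm_mem`, `tate_witness_unique` — "`φ`-Tate on the nose" is the
  membership `bo⁻¹ α ∈ (H²ʳ_cris ⊗ K)^{φ = pʳ}`, with a unique witness (`bo` bijective on a smooth proper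
  model);
* `exists_tateClasses_bo_eq_of_mem_ratAlgebraicClasses`, `exists_tateClasses_bo_eq_add/neg/zero` —
  closure properties, and rational algebraic classes of the special fibre are `φ`-Tate on the nose;
* **sanity of the anchor predicate on the classes the Hodge conjecture predicts**
  (`exists_tateClasses_bo_eq_chDR_restrictGeneric`, `chDR_restrictGeneric_mem_fil`): for a vector
  bundle `E` on `𝒳`, the de Rham Chern character `chᵣ^dR(E|X_K)` of its generic fibre is `φ`-Tate on
  the nose AND lies in `Fʳ` — by `bo (chᵣ^cris(E|X_k)) = chᵣ^dR(E|X_K)` (Berthelot–Ogus 1983, Cor. 3.7,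
  Rem. 3.7.1) and `φ chᵣ^cris = pʳ chᵣ^cris` (Gros 1985) — exactly the two hypotheses (a) "φ-Tate on
  the nose" and "`α ∈ Fʳ`" that P2a places on a seedable class, so the anchor predicate is consistent
  on algebraic classes, as Ogus's "absolutely Tate" philosophy demands (Ogus 1982, §4, before (4.11));
* `PeriodRealization.iso_one_tmul_injective`, `eq_of_iso_one_tmul_eq` — along an embedding
  `τ : K →+* ℂ` a complex de Rham class has AT MOST ONE `K`-rational descent `α` (`1 ⊗ α` is injective
  over a field, Grothendieck's comparison is bijective on smooth projective varieties), which is what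
  makes "THE class `α ∈ Fʳ H²ʳ_dR(𝒳_K/K)` with `α ⊗_ι 1 = β_dR`" of the item's text well defined.

References: A. Ogus, *Hodge cycles and crystalline cohomology*, LNM 900 (1982), §4, (4.1.2), Thm. 4.14
[Ogus1982]; P. Berthelot, A. Ogus, *F-isocrystals and de Rham cohomology I*, Invent. Math. 72 (1983),
Cor. 2.5, Cor. 3.7, Rem. 3.7.1 [BerthelotOgus1983]; A. Grothendieck, *On the de Rham cohomology of
algebraic varieties*, Publ. IHÉS 29 (1966), Thm. 1' [Grothendieck1966].
-/

-- the summit-side namespace `Summit.HodgeConjecture.HodgeConjecture.…` (summit = sub-problem, D-0017)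
-- repeats a component by design; the linter would flag every declaration.
set_option linter.dupNamespace false

noncomputable section

open CategoryTheory AlgebraicGeometry
open scoped TensorProduct Isocrystal
open Literature.AlgebraicGeometry.Motives Literature.AlgebraicGeometry.Motives.WittScheme

namespace Summit.HodgeConjecture.HodgeConjecture.Theorems.AnchorsAtGenericHodgeLocusPoints

/-! ### The `φ = pʳ` eigenspace is a `ℚ`-structure -/

section Crystalline

variable {p : ℕ} [Fact p.Prime] {k : Type} [Field k] [CharP k p] [PerfectRing k p]
  (C : CrystallineRealization p k)

/-- **Tate classes are stable under rational scalars**: if `φ x = pʳ x` then `φ (q • x) = pʳ (q • x)`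
for `q ∈ ℚ`, because `φ` is semilinear over the Frobenius `σ` of `K = W(k)[1/p]` and `σ q = q`
(`map_ratCast`). So `(H²ʳ_cris ⊗ K)^{φ = pʳ}` is a `ℚ`-subspace (indeed a `ℚ_p`-subspace; it is NOT a
`K`-subspace, `σ` moving `K`). [cite: Ogus1982, (4.1.2)] -/
theorem ratCast_smul_mem_tateClasses {X : SchemeOver k} {r : ℕ} {x : C.obj X (2 * r)}
    (hx : x ∈ C.tateClasses X r) (q : ℚ) : (q : K(p, k)) • x ∈ C.tateClasses X r := by
  rw [CrystallineRealization.mem_tateClasses_iff] at hx ⊢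
  rw [LinearEquiv.map_smulₛₗ, map_ratCast, hx, smul_comm]

/-- Integer multiples of Tate classes are Tate classes (the `AddSubgroup` structure, recorded in the
scalar form `(n : K) • x`). [cite: Ogus1982, (4.1.2)] -/
theorem intCast_smul_mem_tateClasses {X : SchemeOver k} {r : ℕ} {x : C.obj X (2 * r)}
    (hx : x ∈ C.tateClasses X r) (n : ℤ) : (n : K(p, k)) • x ∈ C.tateClasses X r := by
  have h := ratCast_smul_mem_tateClasses C hx (n : ℚ)
  rwa [Rat.cast_intCast] at h

/-! ### Cohomologically supersingular fibres: the Tate classes span -/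

/-- **On a cohomologically supersingular variety the `φ`-Tate classes span.** If `X/k` is smooth
projective and every class in `H²ʳ(X) = H²ʳ_cris(X/W) ⊗ K` is a `K`-combination of algebraic classes
(`C.algebraicClasses X r = ⊤`, i.e. `ρ_r(X) = b_{2r}`: supersingular abelian varieties, Shioda–Katsura
Fermat hypersurfaces), then `H²ʳ(X)` is the `K`-span of the eigen-lattice `{x | φ x = pʳ x}`: algebraic
classes are Tate classes (`algebraicLattice_le_tateClasses`, Ogus 1982 §4). [cite: Ogus1982, §4] -/
theorem span_tateClasses_eq_top_of_algebraicClasses_eq_top {n : ℕ} {X : SchemeOver k}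
    (hX : IsSmoothProjective n X) {r : ℕ} (h : C.algebraicClasses X r = ⊤) :
    Submodule.span K(p, k) (C.tateClasses X r : Set (C.obj X (2 * r))) = ⊤ := by
  refine eq_top_iff.2 ?_
  rw [← h]
  unfold PreWeilCohomology.algebraicClasses
  exact Submodule.span_mono fun x hx => C.algebraicLattice_le_tateClasses hX r hx

variable {n : ℕ} {𝒳 : SchemeOver (WittVector p k)}

/-- **At an anchor, `H²ʳ_dR(X_K/K)` is spanned by classes that are `φ`-Tate on the nose.** For a smooth
proper model `𝒳/W(k)` whose special fibre is cohomologically supersingular in codimension `r`, the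
Berthelot–Ogus images `bo x` of the Tate classes `x` (`φ x = pʳ x`) span the de Rham cohomology of the
generic fibre over `K` (`bo` is bijective, Berthelot–Ogus 1983, Cor. 2.5). [cite: BerthelotOgus1983, Cor. 2.5] -/
theorem span_bo_image_tateClasses_eq_top (h𝒳 : IsSmoothProperModel n 𝒳) {r : ℕ}
    (h : C.algebraicClasses (specialFibre 𝒳) r = ⊤) :
    Submodule.span K(p, k)
        (C.bo 𝒳 (2 * r) '' (C.tateClasses (specialFibre 𝒳) r : Set (C.obj (specialFibre 𝒳) (2 * r)))) =
      ⊤ := by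
  rw [Submodule.span_image,
    span_tateClasses_eq_top_of_algebraicClasses_eq_top C h𝒳.isSmoothProjective_specialFibre h,
    Submodule.map_top, LinearMap.range_eq_top]
  exact (C.bijective_bo h𝒳 (2 * r)).2

/-! ### "`φ`-Tate on the nose" -/

/-- **"`φ`-Tate on the nose" is membership of `bo⁻¹ α` in the `φ = pʳ` eigenspace**: for a smooth proper
model the Berthelot–Ogus map is a `K`-linear bijection `H²ʳ_cris(X_k/W) ⊗ K ≃ H²ʳ_dR(X_K/K)`
(Berthelot–Ogus 1983, Cor. 2.5; read as Mathlib's `LinearEquiv.ofBijective (C.bo 𝒳 _) (C.bijective_bo h𝒳 _)`),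
and `(∃ x, φ x = pʳ x ∧ bo x = α) ↔ φ (bo⁻¹ α) = pʳ (bo⁻¹ α)`. This is Ogus's formulation
"`σ_cris(α)` is a Tate class" (Ogus 1982, (4.1.2)–(4.1.3), Thm. 4.14). [cite: Ogus1982, (4.1.2)]
[cite: BerthelotOgus1983, Cor. 2.5] -/
theorem exists_tateClasses_bo_eq_iff_symm_mem (h𝒳 : IsSmoothProperModel n 𝒳) {r : ℕ}
    (α : C.dR.obj (genericFibre 𝒳) (2 * r)) :
    (∃ x ∈ C.tateClasses (specialFibre 𝒳) r, C.bo 𝒳 (2 * r) x = α) ↔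
      (LinearEquiv.ofBijective (C.bo 𝒳 (2 * r)) (C.bijective_bo h𝒳 (2 * r))).symm α ∈
        C.tateClasses (specialFibre 𝒳) r := by
  constructor
  · rintro ⟨x, hx, rfl⟩
    rwa [← LinearEquiv.ofBijective_apply (hf := C.bijective_bo h𝒳 (2 * r)),
      LinearEquiv.symm_apply_apply]
  · intro h
    exact ⟨_, h, by
      rw [← LinearEquiv.ofBijective_apply (hf := C.bijective_bo h𝒳 (2 * r)),
        LinearEquiv.apply_symm_apply]⟩

/-- The unique Tate witness: if `α` is `φ`-Tate on the nose then its witness is `bo⁻¹ α` (`bo` is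
injective on a smooth proper model). [cite: BerthelotOgus1983, Cor. 2.5] -/
theorem tate_witness_unique (h𝒳 : IsSmoothProperModel n 𝒳) {r : ℕ}
    {x x' : C.obj (specialFibre 𝒳) (2 * r)} (h : C.bo 𝒳 (2 * r) x = C.bo 𝒳 (2 * r) x') : x = x' :=
  (C.bijective_bo h𝒳 (2 * r)).1 h

/-- `0` is `φ`-Tate on the nose. [cite: Ogus1982, (4.1.2)] -/
theorem exists_tateClasses_bo_eq_zero (r : ℕ) :
    ∃ x ∈ C.tateClasses (specialFibre 𝒳) r, C.bo 𝒳 (2 * r) x = 0 :=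
  ⟨0, zero_mem _, map_zero _⟩

/-- Classes that are `φ`-Tate on the nose are stable under addition. [cite: Ogus1982, (4.1.2)] -/
theorem exists_tateClasses_bo_eq_add {r : ℕ} {α α' : C.dR.obj (genericFibre 𝒳) (2 * r)}
    (h : ∃ x ∈ C.tateClasses (specialFibre 𝒳) r, C.bo 𝒳 (2 * r) x = α)
    (h' : ∃ x ∈ C.tateClasses (specialFibre 𝒳) r, C.bo 𝒳 (2 * r) x = α') :
    ∃ x ∈ C.tateClasses (specialFibre 𝒳) r, C.bo 𝒳 (2 * r) x = α + α' := by
  obtain ⟨x, hx, rfl⟩ := h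
  obtain ⟨x', hx', rfl⟩ := h'
  exact ⟨x + x', add_mem hx hx', map_add _ _ _⟩

/-- Classes that are `φ`-Tate on the nose are stable under negation. [cite: Ogus1982, (4.1.2)] -/
theorem exists_tateClasses_bo_eq_neg {r : ℕ} {α : C.dR.obj (genericFibre 𝒳) (2 * r)}
    (h : ∃ x ∈ C.tateClasses (specialFibre 𝒳) r, C.bo 𝒳 (2 * r) x = α) :
    ∃ x ∈ C.tateClasses (specialFibre 𝒳) r, C.bo 𝒳 (2 * r) x = -α := by
  obtain ⟨x, hx, rfl⟩ := h
  exact ⟨-x, neg_mem hx, map_neg _ _⟩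

/-- Classes that are `φ`-Tate on the nose are stable under RATIONAL scalars (not under `K`).
[cite: Ogus1982, (4.1.2)] -/
theorem exists_tateClasses_bo_eq_ratCast_smul {r : ℕ} {α : C.dR.obj (genericFibre 𝒳) (2 * r)}
    (h : ∃ x ∈ C.tateClasses (specialFibre 𝒳) r, C.bo 𝒳 (2 * r) x = α) (q : ℚ) :
    ∃ x ∈ C.tateClasses (specialFibre 𝒳) r, C.bo 𝒳 (2 * r) x = (q : K(p, k)) • α := by
  obtain ⟨x, hx, rfl⟩ := h
  exact ⟨_, ratCast_smul_mem_tateClasses C hx q, map_smul _ _ _⟩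

/-- **Rational algebraic classes of the special fibre are `φ`-Tate on the nose**: for
`x ∈ ℚ · A^r(X_k)` (`ratAlgebraicClasses`), `bo x` is `φ`-Tate on the nose (cycle classes satisfy
`φ cl(Z) = pʳ cl(Z)`, Ogus 1982 §4 / Gillet–Messing 1987; field `frobK_cycleClass`). [cite: Ogus1982, §4] -/
theorem exists_tateClasses_bo_eq_of_mem_ratAlgebraicClasses (h𝒳 : IsSmoothProperModel n 𝒳) {r : ℕ}
    {x : C.obj (specialFibre 𝒳) (2 * r)} (hx : x ∈ C.ratAlgebraicClasses (specialFibre 𝒳) r) :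
    ∃ y ∈ C.tateClasses (specialFibre 𝒳) r, C.bo 𝒳 (2 * r) y = C.bo 𝒳 (2 * r) x :=
  ⟨x, C.ratAlgebraicClasses_le_tateClasses h𝒳.isSmoothProjective_specialFibre r hx, rfl⟩

/-! ### Sanity: the anchor predicate on Chern characters of bundles extending over `𝒳` -/

/-- **Chern characters of bundles on `𝒳` are `φ`-Tate on the nose.** For a vector bundle `E` on a
smooth proper model `𝒳/W(k)`, the de Rham Chern character `chᵣ^dR(E|X_K)` of its generic fibre is
`bo` of the Tate class `chᵣ^cris(E|X_k)`: `bo (chᵣ^cris(E|X_k)) = chᵣ^dR(E|X_K)` (Berthelot–Ogus 1983,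
Cor. 3.7, Rem. 3.7.1; field `bo_chCris`) and `φ chᵣ^cris = pʳ chᵣ^cris` (Gros 1985;
`CrystallineRealization.frobK_chCris`). Thus the classes the Hodge conjecture predicts — Chern
characters of algebraic bundles — satisfy hypothesis (a) "`φ`-Tate on the nose" of the seed statement
P2a at every anchor: the anchor predicate of P2b is consistent on algebraic classes ("cohomology
classes of algebraic cycles will be absolutely Tate", Ogus 1982, §4). [cite: BerthelotOgus1983, Cor. 3.7 and Rem. 3.7.1]
[cite: Ogus1982, §4] -/
theorem exists_tateClasses_bo_eq_chDR_restrictGeneric (h𝒳 : IsSmoothProperModel n 𝒳)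
    (E : 𝒳.left.Modules) (hE : IsVectorBundle E) (r : ℕ) :
    ∃ x ∈ C.tateClasses (specialFibre 𝒳) r,
      C.bo 𝒳 (2 * r) x = C.chDR (genericFibre 𝒳) (restrictGeneric 𝒳 E) r :=
  ⟨C.chCris (specialFibre 𝒳) (restrictSpecial 𝒳 E) r,
    C.frobK_chCris h𝒳.isSmoothProjective_specialFibre _ r, C.bo_chCris h𝒳 E hE r⟩

/-- … and they lie in the Hodge filtration step `Fʳ H²ʳ_dR(X_K/K)` (algebraic classes are of type
`(r, r)`; `CrystallineRealization.chDR_mem_fil`) — hypothesis "`α ∈ Fʳ`" of P2a. [cite: BerthelotOgus1983, §3] -/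
theorem chDR_restrictGeneric_mem_fil (h𝒳 : IsSmoothProperModel n 𝒳) (E : 𝒳.left.Modules) (r : ℕ) :
    C.chDR (genericFibre 𝒳) (restrictGeneric 𝒳 E) r ∈ C.dR.fil (2 * r) r :=
  C.chDR_mem_fil h𝒳.isSmoothProjective_genericFibre _ r

/-- The two together, in the shape of the hypotheses of P2a (`α ∈ Fʳ`, `α` `φ`-Tate on the nose) for
`α = Φ⁻¹ chᵣ^cris(E|X_k) = chᵣ^dR(E|X_K)`: the Bloch–Esnault–Kerz Hodge condition holds for restrictions
of bundles (`hodgeCondition_restrictSpecial`) and the class is Tate. [cite: BlochEsnaultKerz2014pAdic, Thm. 1.3] -/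
theorem bo_chCris_restrictSpecial_mem_fil_and_tate (h𝒳 : IsSmoothProperModel n 𝒳)
    (E : 𝒳.left.Modules) (hE : IsVectorBundle E) (r : ℕ) :
    C.bo 𝒳 (2 * r) (C.chCris (specialFibre 𝒳) (restrictSpecial 𝒳 E) r) ∈ C.dR.fil (2 * r) r ∧
      C.chCris (specialFibre 𝒳) (restrictSpecial 𝒳 E) r ∈ C.tateClasses (specialFibre 𝒳) r :=
  ⟨C.hodgeCondition_restrictSpecial h𝒳 E hE r, C.frobK_chCris h𝒳.isSmoothProjective_specialFibre _ r⟩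

end Crystalline

/-! ### Uniqueness of the `K`-rational descent of a complex class along `τ : K →+* ℂ` -/

section Period

variable {K : Type} [Field K] [CharZero K] (P : PeriodRealization K) (τ : K →+* ℂ)

/-- **A complex de Rham/Betti class has at most one `K`-rational de Rham descent.** For `X` smooth
projective over `K` and `τ : K →+* ℂ`, the map `α ↦ iso_τ (1 ⊗ α) : Hⁱ_dR(X/K) → Hⁱ_B(X_τ) ⊗ ℂ` is
injective: `α ↦ 1 ⊗ α` is injective over a field (Mathlib `Module.Flat.tensorProduct_mk_injective`) and
Grothendieck's comparison `iso_τ` is bijective on smooth projective varieties (Grothendieck 1966,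
Thm. 1'; `PeriodRealization.bijective_iso`). Hence "the class `α ∈ H²ʳ_dR(𝒳_K/K)` with
`α ⊗_ι 1 = β_dR`" of the item's text is well defined whenever it exists. [cite: Grothendieck1966, Thm. 1'] -/
theorem iso_one_tmul_injective {n : ℕ} {X : SchemeOver K} (hX : IsSmoothProjective n X) (i : ℕ) :
    Function.Injective fun α : P.dR.obj X i => P.iso τ X i ((1 : AlongHom ℂ τ) ⊗ₜ[K] α) :=
  (P.bijective_iso τ hX i).1.comp (Module.Flat.tensorProduct_mk_injective K (P.dR.obj X i) (AlongHom ℂ τ))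

/-- Corollary in the shape used by "of Hodge origin": two `K`-rational classes whose comparison images
are the SAME twisted complex class `(2πi)ʳ (1 ⊗ t)` coincide. [cite: Grothendieck1966, Thm. 1'] -/
theorem eq_of_iso_one_tmul_eq {n : ℕ} {X : SchemeOver K} (hX : IsSmoothProjective n X) {i : ℕ}
    {α α' : P.dR.obj X i} {y : AlongHom ℂ τ ⊗[ℚ] (P.B.comap τ).obj X i}
    (h : P.iso τ X i ((1 : AlongHom ℂ τ) ⊗ₜ[K] α) = y)
    (h' : P.iso τ X i ((1 : AlongHom ℂ τ) ⊗ₜ[K] α') = y) : α = α' :=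
  iso_one_tmul_injective P τ hX i (h.trans h'.symm)

end Period

end Summit.HodgeConjecture.HodgeConjecture.Theorems.AnchorsAtGenericHodgeLocusPoints

end
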